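import Summits.KontsevichZagierPeriods.KontsevichZagierPeriods.Theorems.SoloInformedKZChainToolkit
import HarnessLib
import HarnessLib.Audit

/-!
# SoloInformed — honest chains without catalyst, II: compression, neutralisers, THEOREM CH-3

Solo programme `solo-KontsevichZagierPeriods-informed`, session s262 (file 4; THEOREM CH,
part 3b).

With the toolkit of `SoloInformedKZChainToolkit` (zero representations `Z σ = [σ, 0]`, anchor
`P₀ = [ℝ⁰, 0]`, chains `{s} ~ {s} + {P₀}` (`s` with nonempty domain), `{Z [-1,1]ᵐ} ~ {P₀}`):
* `soloInformedStereo` — the rational compression `z ↦ (2z', |z'|² − 1) / (|z'|² + 1)`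
  (`z' = init z`) of `ℝᵐ⁺¹`: `ℚ`-semialgebraic, differentiable, injective on `z_last = 0`, image
  in `[-1, 1]ᵐ⁺¹`; hence the honest move-(2) step `{Z (σ × {0})} → {Z (S (σ × {0}))}` for EVERY
  `ℚ`-semialgebraic `σ` (zero integrand: no Jacobian condition);
* `soloInformed_chain_create` — from the anchor every family `{u} + N(u)` is produced by honest
  moves, `N(u) = {−u, Z ([-1,1]ᵐ⁺¹ ∖ S(σᵤ × {0}))}` the NEUTRALISER of `u`;
* **THEOREM CH-3** (`soloInformed_chain_of_catalysed`, `soloInformed_equivalent_iff_chain`):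
  for representations with NONEMPTY domains, `KZ.Equivalent r r'` iff `{r}` and `{r'}` themselves
  are connected by a finite chain of honest applications of the rules (1a), (1b), (2), (3) — no
  auxiliary family is needed (`{r} ~ {r} + t + N(t) ~ {r'} + t + N(t) ~ {r'}`, where
  `{s} ~ {s} + t + N(t)` for every `s` with nonempty domain: `soloInformed_chain_grow`);
* `soloInformed_summit_iff_honestChains` — the period conjecture is equivalent to: any two
  rational integral representations with nonempty domains and equal values are connected by a
  finite chain of honest moves.  (Empty domains are handled by the group law: `[∅, f]` and every
  value-zero representation are relations.)

References: [Kontsevich–Zagier 2001, §1.2, "we can pass from one formula to another using only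
rules 1)–3)"]; this work (`nl-elimination.md`, REMARK NF.4; `VERDICT.md` §1).
-/

noncomputable section

namespace Summit.KontsevichZagierPeriods.KontsevichZagierPeriods.Theorems

open Set MeasureTheory MvPolynomial
open Literature.ModelTheory.ExponentialFields
open Literature.NumberTheory.Transcendental Literature.NumberTheory.Transcendental.KZ

/-! ### The rational compression map -/

/-- The denominator `D z = 1 + |init z|²`. [folklore] -/
def soloInformedStereoDen {m : ℕ} (z : Fin (m + 1) → ℝ) : ℝ :=
  1 + ∑ j : Fin m, z (Fin.castSucc j) ^ 2

/-- `1 ≤ D z`. [folklore] -/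
theorem soloInformed_one_le_stereoDen {m : ℕ} (z : Fin (m + 1) → ℝ) :
    1 ≤ soloInformedStereoDen z :=
  le_add_of_nonneg_right (Finset.sum_nonneg fun _ _ => sq_nonneg _)

/-- `0 < D z`. [folklore] -/
theorem soloInformed_stereoDen_pos {m : ℕ} (z : Fin (m + 1) → ℝ) :
    0 < soloInformedStereoDen z := lt_of_lt_of_le one_pos (soloInformed_one_le_stereoDen z)

/-- **The compression map** `S z = (2 init z, |init z|² − 1) / (1 + |init z|²)` (the inverse
stereographic projection of `ℝᵐ` onto the unit sphere of `ℝᵐ⁺¹`, read on the hyperplane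
`z_last = 0`). [folklore] -/
def soloInformedStereo {m : ℕ} (z : Fin (m + 1) → ℝ) : Fin (m + 1) → ℝ :=
  Fin.snoc (fun j : Fin m => 2 * z (Fin.castSucc j) * (soloInformedStereoDen z)⁻¹)
    ((soloInformedStereoDen z - 2) * (soloInformedStereoDen z)⁻¹)

/-- The first `m` coordinates of `S z`. [folklore] -/
@[simp] theorem soloInformedStereo_castSucc {m : ℕ} (z : Fin (m + 1) → ℝ) (j : Fin m) :
    soloInformedStereo z (Fin.castSucc j) =
      2 * z (Fin.castSucc j) * (soloInformedStereoDen z)⁻¹ := by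
  simp [soloInformedStereo]

/-- The last coordinate of `S z`. [folklore] -/
@[simp] theorem soloInformedStereo_last {m : ℕ} (z : Fin (m + 1) → ℝ) :
    soloInformedStereo z (Fin.last m) =
      (soloInformedStereoDen z - 2) * (soloInformedStereoDen z)⁻¹ := by
  simp [soloInformedStereo]

/-- **`S` is injective on the hyperplane `z_last = 0`.** [folklore] -/
theorem soloInformed_stereo_injOn {m : ℕ} :
    InjOn (soloInformedStereo (m := m)) {z | z (Fin.last m) = 0} := by
  intro z hz w hw h
  have hDz := soloInformed_stereoDen_pos z
  have hDw := soloInformed_stereoDen_pos w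
  have e : ∀ D : ℝ, D ≠ 0 → (D - 2) * D⁻¹ = 1 - 2 * D⁻¹ := fun D hD => by
    rw [sub_mul, mul_inv_cancel₀ hD]
  have hlast := congr_fun h (Fin.last m)
  rw [soloInformedStereo_last, soloInformedStereo_last, e _ hDz.ne', e _ hDw.ne'] at hlast
  have hD : soloInformedStereoDen z = soloInformedStereoDen w := inv_inj.mp (by linarith)
  apply soloInformed_eq_of_init_eq
  · funext j
    have hj := congr_fun h (Fin.castSucc j)
    rw [soloInformedStereo_castSucc, soloInformedStereo_castSucc, hD] at hj
    have h2 := mul_right_cancel₀ (inv_ne_zero hDw.ne') hj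
    show z (Fin.castSucc j) = w (Fin.castSucc j)
    linarith
  · rw [mem_setOf_eq] at hz hw
    rw [hz, hw]

/-- `|x| ≤ D` and `0 < D` give `x · D⁻¹ ∈ [-1, 1]`. [folklore] -/
theorem soloInformed_mul_inv_mem_Icc {x D : ℝ} (hD : 0 < D) (h : |x| ≤ D) :
    -1 ≤ x * D⁻¹ ∧ x * D⁻¹ ≤ 1 := by
  rw [← div_eq_mul_inv]
  obtain ⟨h1, h2⟩ := abs_le.mp h
  exact ⟨(le_div_iff₀ hD).2 (by linarith), (div_le_one hD).2 h2⟩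

/-- **The image of `S` lies in the cube `[-1, 1]ᵐ⁺¹`.** [folklore] -/
theorem soloInformed_stereo_mem_symCube {m : ℕ} (z : Fin (m + 1) → ℝ) :
    soloInformedStereo z ∈ soloInformedSymCube (m + 1) := by
  rw [soloInformed_mem_symCube_iff]
  have hD1 := soloInformed_one_le_stereoDen z
  have hD0 := soloInformed_stereoDen_pos z
  intro i
  induction i using Fin.lastCases with
  | last =>
    rw [soloInformedStereo_last]
    exact soloInformed_mul_inv_mem_Icc hD0 (abs_le.mpr ⟨by linarith, by linarith⟩)
  | cast j =>
    rw [soloInformedStereo_castSucc]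
    refine soloInformed_mul_inv_mem_Icc hD0 ?_
    have h1 : z (Fin.castSucc j) ^ 2 ≤ ∑ i : Fin m, z (Fin.castSucc i) ^ 2 :=
      Finset.single_le_sum (f := fun i : Fin m => z (Fin.castSucc i) ^ 2)
        (fun i _ => sq_nonneg _) (Finset.mem_univ j)
    have h2 := two_mul_le_add_sq |z (Fin.castSucc j)| 1
    rw [sq_abs] at h2
    rw [abs_mul, abs_two]
    unfold soloInformedStereoDen
    linarith

/-- The denominator as a polynomial over `ℚ`. [folklore] -/
def soloInformedStereoDenPoly (m : ℕ) : MvPolynomial (Fin (m + 1)) ℚ :=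
  1 + ∑ j : Fin m, X (Fin.castSucc j) ^ 2

/-- Evaluation of the denominator polynomial. [folklore] -/
@[simp] theorem soloInformed_aeval_stereoDenPoly {m : ℕ} (z : Fin (m + 1) → ℝ) :
    aeval z (soloInformedStereoDenPoly m) = soloInformedStereoDen z := by
  simp [soloInformedStereoDenPoly, soloInformedStereoDen]

/-- **`S` is a `ℚ`-semialgebraic map** on every `ℚ`-semialgebraic set (its coordinates are
quotients of polynomials over `ℚ` with non-vanishing denominator). [BCR 1998, Prop. 2.2.6] -/
theorem soloInformed_isSemialgebraicMapOn_stereo {m : ℕ} {s : Set (Fin (m + 1) → ℝ)}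
    (hs : IsSemialgebraic ℚ s) : IsSemialgebraicMapOn ℚ s soloInformedStereo := by
  refine IsSemialgebraicMapOn.of_forall hs fun i => ?_
  have hq : ∀ x ∈ s, aeval x (soloInformedStereoDenPoly m) ≠ 0 := fun x _ => by
    rw [soloInformed_aeval_stereoDenPoly]
    exact (soloInformed_stereoDen_pos x).ne'
  induction i using Fin.lastCases with
  | last =>
    refine (isSemialgebraicFunOn_aeval_div_aeval hs (soloInformedStereoDenPoly m - 2)
      (soloInformedStereoDenPoly m) hq).congr ?_
    intro x _
    simp [div_eq_mul_inv]
  | cast j =>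
    refine (isSemialgebraicFunOn_aeval_div_aeval hs (2 * X (Fin.castSucc j))
      (soloInformedStereoDenPoly m) hq).congr ?_
    intro x _
    simp [div_eq_mul_inv]

/-- The denominator is differentiable. [folklore] -/
theorem soloInformed_differentiable_stereoDen {m : ℕ} :
    Differentiable ℝ (soloInformedStereoDen (m := m)) := by
  unfold soloInformedStereoDen
  fun_prop

/-- **`S` is differentiable.** [folklore] -/
theorem soloInformed_differentiableAt_stereo {m : ℕ} (z : Fin (m + 1) → ℝ) :
    DifferentiableAt ℝ soloInformedStereo z := by
  have hD := soloInformed_differentiable_stereoDen (m := m)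
  have hDinv : Differentiable ℝ fun x : Fin (m + 1) → ℝ => (soloInformedStereoDen x)⁻¹ :=
    hD.inv fun x => (soloInformed_stereoDen_pos x).ne'
  refine differentiableAt_pi.2 fun i => ?_
  induction i using Fin.lastCases with
  | last =>
    have e : (fun x : Fin (m + 1) → ℝ => soloInformedStereo x (Fin.last m)) =
        fun x => (soloInformedStereoDen x - 2) * (soloInformedStereoDen x)⁻¹ :=
      funext fun x => soloInformedStereo_last x
    rw [e]
    exact ((hD.sub_const 2).mul hDinv).differentiableAt
  | cast j =>
    have e : (fun x : Fin (m + 1) → ℝ => soloInformedStereo x (Fin.castSucc j)) =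
        fun x => 2 * x (Fin.castSucc j) * (soloInformedStereoDen x)⁻¹ :=
      funext fun x => soloInformedStereo_castSucc x j
    rw [e]
    have h1 : Differentiable ℝ (fun x : Fin (m + 1) → ℝ => 2 * x (Fin.castSucc j)) := by
      fun_prop
    exact (h1.mul hDinv).differentiableAt

/-- Images of `ℚ`-semialgebraic sets under `S` are `ℚ`-semialgebraic (Tarski–Seidenberg).
[BCR 1998, Prop. 2.2.7] -/
theorem soloInformed_isSemialgebraic_stereo_image {m : ℕ} {s : Set (Fin (m + 1) → ℝ)}
    (hs : IsSemialgebraic ℚ s) : IsSemialgebraic ℚ (soloInformedStereo '' s) :=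
  IsSemialgebraicMapOn.isSemialgebraic_image_holds (soloInformed_isSemialgebraicMapOn_stereo hs)
    subset_rfl hs

/-- **COMPRESS (move 2)**: for a `ℚ`-semialgebraic `s` inside the hyperplane `z_last = 0`,
`{Z s} → {Z (S s)}` is an honest step (zero integrands: `0 = 0 · |det S'|`).
[Kontsevich–Zagier 2001, §1.2, rule (2)] -/
theorem soloInformed_compress_mem_KZSteps {m : ℕ} {s : Set (Fin (m + 1) → ℝ)}
    (hs : IsSemialgebraic ℚ s) (h0 : s ⊆ {z | z (Fin.last m) = 0}) :
    (({(⟨m + 1, soloInformedZRep s hs⟩ : Σ n, IntegralRep n)} : Multiset (Σ n, IntegralRep n)),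
      ({(⟨m + 1, soloInformedZRep (soloInformedStereo '' s)
          (soloInformed_isSemialgebraic_stereo_image hs)⟩ : Σ n, IntegralRep n)} :
          Multiset (Σ n, IntegralRep n))) ∈ soloInformedKZSteps := by
  refine Or.inl (Or.inr ⟨m + 1, soloInformedZRep s hs, soloInformedZRep (soloInformedStereo '' s)
    (soloInformed_isSemialgebraic_stereo_image hs), soloInformedStereo,
    fun z => fderiv ℝ soloInformedStereo z, soloInformed_isSemialgebraicMapOn_stereo hs, ?_,
    soloInformed_stereo_injOn.mono h0, rfl, ?_, rfl⟩)
  · intro x _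
    exact (soloInformed_differentiableAt_stereo x).hasFDerivAt.hasFDerivWithinAt
  · intro x _
    simp

/-! ### Neutralisers -/

/-- **SHAPE (move 1a)**: `{Z [-1,1]ᴹ} → {Z A, Z ([-1,1]ᴹ ∖ A)}` is an honest step for every
`ℚ`-semialgebraic `A ⊆ [-1,1]ᴹ`. [Kontsevich–Zagier 2001, §1.2, rule (1)] -/
theorem soloInformed_shape_mem_KZSteps {M : ℕ} {A : Set (Fin M → ℝ)} (hA : IsSemialgebraic ℚ A)
    (hAK : A ⊆ soloInformedSymCube M) :
    (({(⟨M, soloInformedZRep (soloInformedSymCube M) (soloInformed_isSemialgebraic_symCube M)⟩ :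
          Σ n, IntegralRep n)} : Multiset (Σ n, IntegralRep n)),
      ({(⟨M, soloInformedZRep A hA⟩ : Σ n, IntegralRep n),
        ⟨M, soloInformedZRep (soloInformedSymCube M \ A)
          ((soloInformed_isSemialgebraic_symCube M).diff hA)⟩} : Multiset (Σ n, IntegralRep n)))
      ∈ soloInformedKZSteps := by
  refine Or.inl (Or.inl (Or.inl ⟨M,
    soloInformedZRep (soloInformedSymCube M) (soloInformed_isSemialgebraic_symCube M),
    soloInformedZRep A hA,
    soloInformedZRep (soloInformedSymCube M \ A) ((soloInformed_isSemialgebraic_symCube M).diff hA),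
    ?_, ?_, fun _ _ => rfl, fun _ _ => rfl, rfl⟩))
  · show soloInformedSymCube M = A ∪ (soloInformedSymCube M \ A)
    rw [union_sdiff_cancel hAK]
  · show volume (A ∩ (soloInformedSymCube M \ A)) = 0
    rw [inter_sdiff_self]
    exact measure_empty

/-- The lifted domain `σ × {0}` lies in the hyperplane `z_last = 0`. [folklore] -/
theorem soloInformed_zslab_zero_subset {m : ℕ} (σ : Set (Fin m → ℝ)) :
    soloInformedZSlab σ 0 0 ⊆ {z | z (Fin.last m) = 0} :=
  fun _ hz => le_antisymm hz.2.2 hz.2.1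

/-- `σ × {0}` is `ℚ`-semialgebraic. [BCR 1998, §2.1] -/
theorem soloInformed_isSemialgebraic_zslab_zero {m : ℕ} {σ : Set (Fin m → ℝ)}
    (hσ : IsSemialgebraic ℚ σ) : IsSemialgebraic ℚ (soloInformedZSlab σ 0 0) := by
  simpa using soloInformed_isSemialgebraic_zslab hσ 0 0

/-- The SHADOW `S(σᵤ × {0}) ⊆ [-1,1]ᵐ⁺¹` of a representation `u` of dimension `m`. [folklore] -/
def soloInformedShadow {m : ℕ} (u : IntegralRep m) : Set (Fin (m + 1) → ℝ) :=
  soloInformedStereo '' soloInformedZSlab u.domain 0 0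

/-- The shadow is `ℚ`-semialgebraic. [BCR 1998, Prop. 2.2.7] -/
theorem soloInformed_isSemialgebraic_shadow {m : ℕ} (u : IntegralRep m) :
    IsSemialgebraic ℚ (soloInformedShadow u) :=
  soloInformed_isSemialgebraic_stereo_image
    (soloInformed_isSemialgebraic_zslab_zero u.isSemialgebraic_domain)

/-- The shadow lies in the cube. [folklore] -/
theorem soloInformed_shadow_subset_symCube {m : ℕ} (u : IntegralRep m) :
    soloInformedShadow u ⊆ soloInformedSymCube (m + 1) := by
  rintro _ ⟨z, _, rfl⟩
  exact soloInformed_stereo_mem_symCube z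

/-- **The neutraliser** `N(u) = {−u, Z ([-1,1]ᵐ⁺¹ ∖ shadow u)}` of a representation `u`: the family
which, together with `u`, can be created from (and annihilated into) the anchor by honest moves.
[this work] -/
def soloInformedNeutraliser : (Σ n, IntegralRep n) → Multiset (Σ n, IntegralRep n)
  | ⟨m, u⟩ => {⟨m, u.neg⟩,
      ⟨m + 1, soloInformedZRep (soloInformedSymCube (m + 1) \ soloInformedShadow u)
        ((soloInformed_isSemialgebraic_symCube (m + 1)).diff
          (soloInformed_isSemialgebraic_shadow u))⟩}

/-- **CREATE**: `{P₀} ~ {u} + N(u)` for every representation `u` — anchor → ladder up to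
`Z [-1,1]ᵐ⁺¹` → cut out the shadow (1a) → decompress it (2) → drop to `Z σᵤ` (3) → split
`0 = fᵤ + (−fᵤ)` (1b). [this work] -/
theorem soloInformed_chain_create (m : ℕ) (u : IntegralRep m) :
    SoloInformedMoveChain soloInformedKZSteps
      ({(⟨0, soloInformedAnchor⟩ : Σ n, IntegralRep n)} : Multiset (Σ n, IntegralRep n))
      ({(⟨m, u⟩ : Σ n, IntegralRep n)} + soloInformedNeutraliser ⟨m, u⟩) := by
  have h1 := (soloInformed_chain_symCube_anchor (m + 1)).symm
  have h2 := SoloInformedMoveChain.of_mem (soloInformed_shape_mem_KZSteps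
    (soloInformed_isSemialgebraic_shadow u) (soloInformed_shadow_subset_symCube u))
  rw [soloInformed_pair_eq] at h2
  have h3 := (SoloInformedMoveChain.of_mem (soloInformed_compress_mem_KZSteps
    (soloInformed_isSemialgebraic_zslab_zero u.isSemialgebraic_domain)
    (soloInformed_zslab_zero_subset u.domain))).symm
  have h4 := SoloInformedMoveChain.of_mem
    (soloInformed_lift_mem_KZSteps u.domain u.isSemialgebraic_domain)
  have h5 := soloInformed_chain_split u
  refine h1.trans (h2.trans ?_)
  rw [soloInformedNeutraliser, soloInformed_pair_eq, ← add_assoc]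
  exact (h3.trans (h4.trans h5)).add_right _

/-- **GROW**: `{s} ~ {s} + t + N(t)` for every `s` with nonempty domain and every finite family
`t`, where `N(t) = Σ_{u ∈ t} N(u)`. [this work] -/
theorem soloInformed_chain_grow {n : ℕ} (s : IntegralRep n) (hs : s.domain.Nonempty)
    (t : Multiset (Σ n, IntegralRep n)) :
    SoloInformedMoveChain soloInformedKZSteps
      ({(⟨n, s⟩ : Σ n, IntegralRep n)} : Multiset (Σ n, IntegralRep n))
      ({(⟨n, s⟩ : Σ n, IntegralRep n)} + t + t.bind soloInformedNeutraliser) := by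
  induction t using Multiset.induction_on with
  | empty => simpa using SoloInformedMoveChain.refl _
  | cons u t ih =>
    obtain ⟨m, u⟩ := u
    have h1 := (soloInformed_chain_spawn s hs).trans
      ((soloInformed_chain_create m u).add_left {(⟨n, s⟩ : Σ n, IntegralRep n)})
    have h2 := h1.add_right (t + t.bind soloInformedNeutraliser)
    rw [add_assoc] at ih
    rw [Multiset.cons_bind, show ∀ (a b c d : Multiset (Σ n, IntegralRep n))
      (x : Σ n, IntegralRep n), a + x ::ₘ b + (c + d) = a + ({x} + c) + (b + d) from
        fun a b c d x => by rw [← Multiset.singleton_add]; abel]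
    exact ih.trans h2

/-- **Catalyst removal.** If `{r} + t ~ {r'} + t` by honest moves and `r`, `r'` have nonempty
domains, then `{r} ~ {r'}` by honest moves: `{r} ~ {r} + t + N(t) ~ {r'} + t + N(t) ~ {r'}`.
[this work] -/
theorem soloInformed_chain_of_catalysed {n m : ℕ} {r : IntegralRep n} {r' : IntegralRep m}
    (hr : r.domain.Nonempty) (hr' : r'.domain.Nonempty) {t : Multiset (Σ n, IntegralRep n)}
    (h : SoloInformedMoveChain soloInformedKZSteps ({(⟨n, r⟩ : Σ n, IntegralRep n)} + t)
      ({(⟨m, r'⟩ : Σ n, IntegralRep n)} + t)) :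
    SoloInformedMoveChain soloInformedKZSteps {(⟨n, r⟩ : Σ n, IntegralRep n)}
      {(⟨m, r'⟩ : Σ n, IntegralRep n)} :=
  (soloInformed_chain_grow r hr t).trans
    ((h.add_right (t.bind soloInformedNeutraliser)).trans
      (soloInformed_chain_grow r' hr' t).symm)

/-! ### THEOREM CH-3 and the summit in honest-chain form -/

/-- **THEOREM CH-3 (honest chains, no catalyst).** For integral representations with nonempty
domains, `KZ.Equivalent r r'` holds iff `{r}` and `{r'}` are connected by a finite chain of honest
applications of the Kontsevich–Zagier rules (1a), (1b), (2), (3), each replacing one side of a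
move instance present in the current finite family of representations by its other side.
[Kontsevich–Zagier 2001, §1.2; this work] -/
theorem soloInformed_equivalent_iff_chain {n m : ℕ} {r : IntegralRep n} {r' : IntegralRep m}
    (hr : r.domain.Nonempty) (hr' : r'.domain.Nonempty) :
    Equivalent r r' ↔ SoloInformedMoveChain soloInformedKZSteps {(⟨n, r⟩ : Σ n, IntegralRep n)}
      {(⟨m, r'⟩ : Σ n, IntegralRep n)} := by
  refine ⟨fun h => ?_, fun h => soloInformed_equivalent_of_chain (t := 0) (by simpa using h)⟩
  obtain ⟨t, ht⟩ := (soloInformed_equivalent_iff_exists_chain r r').1 h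
  exact soloInformed_chain_of_catalysed hr hr' ht

/-- A representation with EMPTY domain is a relation (`∅ = ∅ ∪ ∅`, move 1a).
[Kontsevich–Zagier 2001, §1.2, rule (1)] -/
theorem soloInformed_of_mem_relations_of_domain_empty {n : ℕ} (r : IntegralRep n)
    (h : r.domain = ∅) : of r ∈ relations := by
  have hmem : of r - of r - of r ∈ relations :=
    domainAddRel_subset_relations ⟨n, r, r, r, (union_self _).symm,
      by rw [inter_self, h]; exact measure_empty, fun _ _ => rfl, fun _ _ => rfl, rfl⟩
  rw [show of r - of r - of r = -of r by abel] at hmem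
  exact neg_mem_iff.mp hmem

/-- A zero representation is a relation (`0 = 0 + 0`, move 1b).
[Kontsevich–Zagier 2001, §1.2, rule (1)] -/
theorem soloInformed_of_zrep_mem_relations {n : ℕ} (σ : Set (Fin n → ℝ))
    (hσ : IsSemialgebraic ℚ σ) : of (soloInformedZRep σ hσ) ∈ relations := by
  have hmem : of (soloInformedZRep σ hσ) - of (soloInformedZRep σ hσ) -
      of (soloInformedZRep σ hσ) ∈ relations :=
    integrandAddRel_subset_relations ⟨n, soloInformedZRep σ hσ, soloInformedZRep σ hσ,
      soloInformedZRep σ hσ, rfl, rfl, fun _ _ => by simp, rfl⟩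
  rw [show of (soloInformedZRep σ hσ) - of (soloInformedZRep σ hσ) -
    of (soloInformedZRep σ hσ) = -of (soloInformedZRep σ hσ) by abel] at hmem
  exact neg_mem_iff.mp hmem

/-- **The period conjecture in honest-chain form.** `KontsevichZagierPeriods` holds iff any two
rational integral representations with NONEMPTY domains and equal values are connected by a
finite chain of honest applications of the rules (1a), (1b), (2), (3).  (Representations with
empty domain, and value-zero representations, are relations outright; they account for the
remaining cases of the `ℤ`-span statement.)
[Kontsevich–Zagier 2001, §1.2, Conjecture 1; this work] -/
theorem soloInformed_summit_iff_honestChains :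
    KontsevichZagierPeriods ↔
      ∀ ⦃n m : ℕ⦄ (r : IntegralRep n) (r' : IntegralRep m), r.IsRational → r'.IsRational →
        r.domain.Nonempty → r'.domain.Nonempty → r.value = r'.value →
        SoloInformedMoveChain soloInformedKZSteps {(⟨n, r⟩ : Σ n, IntegralRep n)}
          {(⟨m, r'⟩ : Σ n, IntegralRep n)} := by
  rw [KontsevichZagierPeriods_iff]
  refine ⟨fun h n m r r' hr hr' hne hne' hv =>
    (soloInformed_equivalent_iff_chain hne hne').1 (h r r' hr hr' hv), fun H => ?_⟩
  -- value-zero rational representations with nonempty domain are relations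
  have key : ∀ {k : ℕ} (s : IntegralRep k), s.IsRational → s.domain.Nonempty → s.value = 0 →
      of s ∈ relations := by
    intro k s hs hne hv0
    have hc := H s (soloInformedZRep s.domain s.isSemialgebraic_domain) hs
      (soloInformedZRep_isRational _ _) hne hne (by rw [hv0, soloInformedZRep_value])
    have he : of s - of (soloInformedZRep s.domain s.isSemialgebraic_domain) ∈ relations :=
      (soloInformed_equivalent_iff_chain (r := s)
        (r' := soloInformedZRep s.domain s.isSemialgebraic_domain) hne hne).2 hc
    have hz := soloInformed_of_zrep_mem_relations s.domain s.isSemialgebraic_domain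
    simpa using relations.add_mem he hz
  intro n m r r' hr hr' hv
  show of r - of r' ∈ relations
  by_cases hne : r.domain.Nonempty <;> by_cases hne' : r'.domain.Nonempty
  · exact (soloInformed_equivalent_iff_chain hne hne').2 (H r r' hr hr' hne hne' hv)
  · rw [not_nonempty_iff_eq_empty] at hne'
    exact relations.sub_mem (key r hr hne (hv.trans (by simp [IntegralRep.value, hne'])))
      (soloInformed_of_mem_relations_of_domain_empty r' hne')
  · rw [not_nonempty_iff_eq_empty] at hne
    exact relations.sub_mem (soloInformed_of_mem_relations_of_domain_empty r hne)
      (key r' hr' hne' (hv.symm.trans (by simp [IntegralRep.value, hne])))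
  · rw [not_nonempty_iff_eq_empty] at hne hne'
    exact relations.sub_mem (soloInformed_of_mem_relations_of_domain_empty r hne)
      (soloInformed_of_mem_relations_of_domain_empty r' hne')

end Summit.KontsevichZagierPeriods.KontsevichZagierPeriods.Theorems
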